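import Summits.NavierStokesRegularity.NavierStokesRegularity.Theses.PalasekTowerBreakdown
import Summits.NavierStokesRegularity.FluidComputer.PalasekTowerHeredityWitnessUnconditionalRungs
import Summits.NavierStokesRegularity.FluidComputer.PalasekTowerHeredityWitnessTower

/-!
# NavierStokesRegularity — route `PalasekTowerBreakdown`, item `HeredityFromTwo`: the item is a statement about
# the LEVELS each admissible design REACHES — «no design dies at a generic level», by name

Supports `stmt-NavierStokesRegularity-19250` (`PalasekTowerBreakdown.HeredityFromTwo := HeredityFrom 2`; it does
NOT close it). Cell `ns-blowup`, seat `ns-palasek-19250-p1` (g2, lead of record; skeleton v3 c7f4b5fa45c722f3).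
LABEL: E–C typing + kernel glue (over `Stage.exists_extends_of_stage_succ`, ecbridge-6 g2, p-file
`FluidComputer/PalasekTowerHeredityWitnessUnconditionalRungs.lean`: any registered stage one level up extends any
registered stage of the same design — velocity uniqueness W14-free, pressure re-gauged). WHAT THIS IS NOT: not NS —
no stage, flow or tower is constructed; the item is OPEN and appears only inside equivalences / implications.

For an admissible design `S` (pinned `Λ = 8`, `θ = 6/5`, rigid, quiet, wide rates) write
`Reach S k := Nonempty (Stage 1 wide S routeG k)` («the design's flow realises the register's levels `0 … k`»).
`Reach S` is a down-set of `ℕ` (`Stage.restrictOfAntitone`). By name on the route decl: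

* `palasekTowerBreakdown_heredityFromTwo_iff_nonempty_succ` — `HeredityFromTwo ↔ ∀ S adm, ∀ k ≥ 2, Reach S k →
  Reach S (k+1)` (no hypothesis): the `∀ s ∃ s', s.Extends s'` bookkeeping carries no information beyond WHICH
  LEVELS a design reaches;
* `palasekTowerBreakdown_heredityFromTwo_iff_two_reaches_all` — `HeredityFromTwo ↔ ∀ S adm, Reach S 2 → ∀ k,
  Reach S k`: THE DICHOTOMY PER DESIGN — under the item every admissible design either never reaches level `2`
  (`Reach S ⊆ {0, 1}`) or reaches every level (`Reach S = ℕ`), i.e. «no admissible design dies at a generic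
  level»; conversely that dichotomy IS the item;
* `palasekTowerBreakdown_heredityFromTwo_breakdownR3_of_reaches_two` — and a design reaching every level is a
  finite-time breakdown of a smooth forced solution (`navierStokesBreakdownR3_of_nonempty_stages`): under the
  item, ONE admissible design reaching level `2` proves Fefferman's (C) (per-design form of p445539's rung
  theorem); contrapositively, in a world without breakdown the item says exactly that NO admissible design
  reaches level `2` (`palasekTowerBreakdown_heredityFromTwo_iff_isEmpty_two_of_not_breakdownR3`, per-design form
  of p446081).

References: S. Palasek, arXiv:2605.13827 §4 [cite: Palasek2026ElementaryModel, §4]; H. Sohr, *The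
Navier–Stokes Equations*, Birkhäuser 2001, Ch. V Thm. 1.5.1 [cite: Sohr2001, Ch. V Thm. 1.5.1].
-/

-- `Summit.<Summit>.<Problem>` is the tree's mandated summit-side namespace (CONVENTIONS §2); for this
-- single-conjunct summit the two coincide, so the duplicate is deliberate.
set_option linter.dupNamespace false

namespace Summit.NavierStokesRegularity.NavierStokesRegularity.Theorems

open Set MeasureTheory
open scoped ENNReal ContDiff
open Literature.Analysis.FluidPDE
open Summit.NavierStokesRegularity.NavierStokesRegularity.Theses
open Summit.NavierStokesRegularity.FluidComputer.PalasekTowerClayBridge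

/-- **`HeredityFromTwo` ⇔ «every admissible design that reaches a level `k ≥ 2` reaches level `k + 1`»** — no
hypothesis (`Stage.exists_extends_of_stage_succ` for `⇐`). [cite: Sohr2001, Ch. V Thm. 1.5.1] -/
theorem palasekTowerBreakdown_heredityFromTwo_iff_nonempty_succ :
    PalasekTowerBreakdown.HeredityFromTwo ↔
      ∀ S : Schedule TowerRates.wide, S.Pins 8 (6 / 5) → S.Rigid → S.Quiet → ∀ k : ℕ, 2 ≤ k →
        Nonempty (Stage 1 TowerRates.wide S (Margins.routeG TowerRates.wide) k) →
          Nonempty (Stage 1 TowerRates.wide S (Margins.routeG TowerRates.wide) (k + 1)) := by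
  unfold PalasekTowerBreakdown.HeredityFromTwo
  constructor
  · rintro h S hP hR hQ k hk ⟨s⟩
    obtain ⟨s', -⟩ := h S hP hR hQ k hk s
    exact ⟨s'⟩
  · intro h S hP hR hQ k hk s
    obtain ⟨s₁⟩ := h S hP hR hQ k hk ⟨s⟩
    exact s.exists_extends_of_stage_succ one_pos s₁

/-- **THE DICHOTOMY PER DESIGN**: `HeredityFromTwo` ⇔ «every admissible design that reaches level `2` reaches
EVERY level» — no hypothesis. Under the item the set of levels an admissible design reaches is `⊆ {0, 1}` or all
of `ℕ`: no design dies at a generic level. (Up from `2` by the previous theorem; down from `2` by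
`Stage.restrictOfAntitone`.) [cite: Sohr2001, Ch. V Thm. 1.5.1] -/
theorem palasekTowerBreakdown_heredityFromTwo_iff_two_reaches_all :
    PalasekTowerBreakdown.HeredityFromTwo ↔
      ∀ S : Schedule TowerRates.wide, S.Pins 8 (6 / 5) → S.Rigid → S.Quiet →
        Nonempty (Stage 1 TowerRates.wide S (Margins.routeG TowerRates.wide) 2) →
          ∀ k : ℕ, Nonempty (Stage 1 TowerRates.wide S (Margins.routeG TowerRates.wide) k) := by
  rw [palasekTowerBreakdown_heredityFromTwo_iff_nonempty_succ]
  constructor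
  · intro h S hP hR hQ h2
    have up : ∀ n : ℕ, Nonempty (Stage 1 TowerRates.wide S (Margins.routeG TowerRates.wide) (2 + n)) := by
      intro n
      induction n with
      | zero => exact h2
      | succ n ih => exact h S hP hR hQ (2 + n) (Nat.le_add_right 2 n) ih
    intro k
    rcases le_or_gt k 2 with hk | hk
    · obtain ⟨s⟩ := h2
      exact ⟨s.restrictOfAntitone (Margins.antitone_routeG TowerRates.wide) hk⟩
    · obtain ⟨n, rfl⟩ : ∃ n, k = 2 + n := ⟨k - 2, by omega⟩
      exact up n
  · intro h S hP hR hQ k hk hk'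
    obtain ⟨s⟩ := hk'
    exact h S hP hR hQ ⟨s.restrictOfAntitone (Margins.antitone_routeG TowerRates.wide) hk⟩ (k + 1)

/-- **Under the item, ONE admissible design reaching level `2` is Fefferman's (C)** (per-design form of the rung
theorem: the design then reaches every level, and a design reaching every level is a finite-time breakdown,
`navierStokesBreakdownR3_of_nonempty_stages`). [cite: Palasek2026ElementaryModel, §4] -/
theorem palasekTowerBreakdown_heredityFromTwo_breakdownR3_of_reaches_two
    (h : PalasekTowerBreakdown.HeredityFromTwo) {S : Schedule TowerRates.wide} (hP : S.Pins 8 (6 / 5))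
    (hR : S.Rigid) (hQ : S.Quiet) (h2 : Nonempty (Stage 1 TowerRates.wide S (Margins.routeG TowerRates.wide) 2)) :
    Summit.NavierStokesRegularity.NavierStokesRegularity.NavierStokesBreakdownR3 :=
  navierStokesBreakdownR3_of_nonempty_stages one_pos
    (palasekTowerBreakdown_heredityFromTwo_iff_two_reaches_all.1 h S hP hR hQ h2)

/-- **In a world without breakdown the item IS the level-`2` amplification cap, per design**:
`¬ NavierStokesBreakdownR3 → (HeredityFromTwo ↔ ∀ S adm, IsEmpty (Stage 1 wide S routeG 2))` — no admissible
design's flow realises the register's levels `0, 1, 2`. [cite: Palasek2026ElementaryModel, §4] -/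
theorem palasekTowerBreakdown_heredityFromTwo_iff_isEmpty_two_of_not_breakdownR3
    (hC : ¬ Summit.NavierStokesRegularity.NavierStokesRegularity.NavierStokesBreakdownR3) :
    PalasekTowerBreakdown.HeredityFromTwo ↔
      ∀ S : Schedule TowerRates.wide, S.Pins 8 (6 / 5) → S.Rigid → S.Quiet →
        IsEmpty (Stage 1 TowerRates.wide S (Margins.routeG TowerRates.wide) 2) := by
  constructor
  · intro h S hP hR hQ
    by_contra hne
    rw [not_isEmpty_iff] at hne
    exact hC (palasekTowerBreakdown_heredityFromTwo_breakdownR3_of_reaches_two h hP hR hQ hne)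
  · intro h
    rw [palasekTowerBreakdown_heredityFromTwo_iff_nonempty_succ]
    intro S hP hR hQ k hk hk'
    obtain ⟨s⟩ := hk'
    exact ((h S hP hR hQ).false (s.restrictOfAntitone (Margins.antitone_routeG TowerRates.wide) hk)).elim

/-- The unconditional half of the previous equivalence: the level-`2` cap proves the item outright (vacuously),
per design. [folklore] -/
theorem palasekTowerBreakdown_heredityFromTwo_of_isEmpty_two
    (h : ∀ S : Schedule TowerRates.wide, S.Pins 8 (6 / 5) → S.Rigid → S.Quiet →
      IsEmpty (Stage 1 TowerRates.wide S (Margins.routeG TowerRates.wide) 2)) :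
    PalasekTowerBreakdown.HeredityFromTwo := by
  rw [palasekTowerBreakdown_heredityFromTwo_iff_nonempty_succ]
  intro S hP hR hQ k hk hk'
  obtain ⟨s⟩ := hk'
  exact ((h S hP hR hQ).false (s.restrictOfAntitone (Margins.antitone_routeG TowerRates.wide) hk)).elim

end Summit.NavierStokesRegularity.NavierStokesRegularity.Theorems
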